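import Literature.AlgebraicGeometry.HodgeTheory.AbelianVarietyStableSubvarietiesClassification
import Literature.AlgebraicGeometry.Motives.AbelianVarietyPoincareCompleteReducibility
import HarnessLib

/-!
# Exactly two `End X`-stable abelian subvarieties iff `End⁰(X)` is a simple ring iff `X` is isotypic; in general their number is
# `2^{#blocks of End⁰ X}` (Mumford §19 Cor. 1–2; Lange 2023 Cor. 2.4.26; Lam §22 Prop. (22.1))

Layer `Literature/AlgebraicGeometry/HodgeTheory`; theorems only (no `def`, no instance, no named fact; net debt 0).  Sequel of
`HodgeTheory/AbelianVarietyStableSubvarietiesClassification` (`#{End X-stable abelian subvarieties} = #{central idempotents of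
End⁰ X} = 2^r`).  The companion of the tree's «`X` is simple iff `X` has exactly two abelian subvarieties»
(`…SimpleIffEndAlgebra.isSimple_iff_natCard_setOf_range_subvariety_eq_two`): over a perfect field **`X` has exactly two
`End X`-stable abelian subvarieties (`0` and `X`) iff `End⁰ X` is a simple ring iff `X ∼ C^{n+1}` is ISOTYPIC**, and in general
the number of `End X`-stable abelian subvarieties is `2^{b}` with `b` the number of blocks (centrally primitive idempotents) of
`End⁰ X`; a simple `X` of positive dimension, and every power `C^{n+1}` of a simple `C`, has exactly two.

THE PRINT.  Mumford, *Abelian Varieties* §19 Cor. 1–2 of Thm. 1 (pp. 173–174: `End⁰ X = ⊕_i M_{n_i}(D_i)`, simple iff one type);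
Lange, *Abelian Varieties over the Complex Numbers* (2023) §2.4.4 Cor. 2.4.26 (PDF p. 124: `End_ℚ(X)` simple iff `X` isotypic);
Lam, *A First Course in Noncommutative Rings* §22 Prop. (22.1) (p. 326) and p. 328 (a simple ring is a single block).

Results (namespace `Literature.AlgebraicGeometry.HodgeTheory.AbelianVariety`; perfect field, every `X`):
**`natCard_setOf_range_stable_subvariety_eq_two_pow_ncard_blocks`** (`= 2^{#blocks of End⁰ X}`),
**`natCard_setOf_range_stable_subvariety_eq_two_iff_isSimpleRing`**, **`natCard_setOf_range_stable_subvariety_eq_two_iff_isotypic`**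
(`= 2` iff `X ∼ C^{n+1}` with `C` simple of positive dimension), `natCard_setOf_range_stable_subvariety_eq_two_of_isSimple`,
`natCard_setOf_range_stable_subvariety_biproduct_const_eq_two` (`C^{n+1}` has exactly two although, for `n ≥ 1`, infinitely many
abelian subvarieties).

## References
* [MumfordAV1970] D. Mumford, *Abelian Varieties* (1970), §19 Thm. 1, Cor. 1–2 (pp. 173–174).
* [Lange2023AbelianVarietiesComplex] H. Lange, *Abelian Varieties over the Complex Numbers* (2023), §2.4.4 Cor. 2.4.26 (PDF p. 124).
* [Lam2001FirstCourse] T. Y. Lam, *A First Course in Noncommutative Rings*, 2nd ed. (2001), §22 Prop. (22.1) p. 326, p. 328.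
-/

noncomputable section

universe u

open CategoryTheory CategoryTheory.Limits

namespace Literature.AlgebraicGeometry.HodgeTheory

namespace AbelianVariety

open _root_.AlgebraicGeometry
open Literature.AlgebraicGeometry.Motives Literature.AlgebraicGeometry.Motives.AbelianVariety
open Literature.RingTheory.Idempotents

variable {K : Type u} [Field K] [PerfectField K] (X : Motives.AbelianVariety K)

/-- **`#{End X-stable abelian subvarieties} = 2^{#blocks of End⁰ X}`** (blocks = centrally primitive idempotents; perfect field).
[cite: Lam2001FirstCourse, §22 Prop. (22.1) p. 326] [cite: MumfordAV1970, §19 Cor. 1–2 of Thm. 1 (pp. 173–174)] -/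
theorem natCard_setOf_range_stable_subvariety_eq_two_pow_ncard_blocks :
    Nat.card {R : Set X.X.left | ∃ (Z : Motives.AbelianVariety K) (j : Z ⟶ X), IsClosedImmersion (Hom.toSchemeHom j) ∧
        R = Set.range (Hom.toSchemeHom j) ∧ ∀ φ : X ⟶ X, Set.range (Hom.toSchemeHom (j ≫ φ)) ⊆ Set.range (Hom.toSchemeHom j)} =
      2 ^ {z : X.endAlgebra | IsCentrallyPrimitive z}.ncard := by
  obtain ⟨r, B, n, Y, i, -, -, -, -, -, -, hblocks, hcentral⟩ := exists_ncard_blocks_endAlgebra X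
  rw [natCard_setOf_range_stable_subvariety_eq_ncard_central_idempotents X, hcentral, hblocks]

/-- **EXACTLY TWO `End X`-STABLE ABELIAN SUBVARIETIES IFF `End⁰ X` IS A SIMPLE RING** (perfect field; a simple ring has the two
central idempotents `0, 1`; conversely `2^r = 2` forces one isotypic component, `X ∼ Y ∼ B^{n+1}`, `End⁰ X ≅ M_{n+1}(End⁰ B)` simple).
[cite: Lange2023AbelianVarietiesComplex, §2.4.4 Cor. 2.4.26 (PDF p. 124)] [cite: Lam2001FirstCourse, §22 p. 328] [cite: MumfordAV1970, §19 Cor. 2 of Thm. 1 (p. 174)] -/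
theorem natCard_setOf_range_stable_subvariety_eq_two_iff_isSimpleRing :
    Nat.card {R : Set X.X.left | ∃ (Z : Motives.AbelianVariety K) (j : Z ⟶ X), IsClosedImmersion (Hom.toSchemeHom j) ∧
        R = Set.range (Hom.toSchemeHom j) ∧ ∀ φ : X ⟶ X, Set.range (Hom.toSchemeHom (j ≫ φ)) ⊆ Set.range (Hom.toSchemeHom j)} = 2 ↔
      IsSimpleRing X.endAlgebra := by
  rw [natCard_setOf_range_stable_subvariety_eq_ncard_central_idempotents X]
  constructor
  · intro h2
    obtain ⟨r, B, n, Y, i, hB, hB0, hni, hi, hY, -, hdesc, -⟩ := exists_isotypicComponents_orthogonal X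
    rw [ncard_setOf_central_idempotent_endAlgebra_eq_two_pow hB hB0 hni hY i hi hdesc, Fintype.card_fin] at h2
    obtain rfl : r = 1 := Nat.pow_right_injective le_rfl (by show 2 ^ r = 2 ^ 1; rw [h2, pow_one])
    have hX : IsIsogenous X (⨁ fun _ : Fin (n default + 1) ↦ B default) :=
      ((IsIsogenous.symm' ⟨_, hdesc⟩).trans ⟨_, isIsogeny_hom_of_iso (biproductUniqueIso (f := Y))⟩).trans (hY default)
    exact isSimpleRing_endAlgebra_of_isIsogenous_biproduct_const (hB default) (hB0 default) hX
  · intro hS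
    haveI := hS
    have hset : {z : X.endAlgebra | IsIdempotentElem z ∧ ∀ a, z * a = a * z} = {0, 1} := by
      ext z
      constructor
      · rintro ⟨hzi, hz⟩
        rcases forall_central_idempotent_trivial_of_isSimpleRing z hzi hz with rfl | rfl <;> simp
      · rintro (rfl | rfl)
        · exact ⟨IsIdempotentElem.zero, fun a ↦ by rw [zero_mul, mul_zero]⟩
        · exact ⟨IsIdempotentElem.one, fun a ↦ by rw [one_mul, mul_one]⟩
    rw [hset, Set.ncard_pair zero_ne_one]

/-- **EXACTLY TWO `End X`-STABLE ABELIAN SUBVARIETIES IFF `X` IS ISOTYPIC**, `X ∼ C^{n+1}` with `C` simple of positive dimension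
(perfect field). [cite: Lange2023AbelianVarietiesComplex, §2.4.4 Cor. 2.4.26 (PDF p. 124)] [cite: MumfordAV1970, §19 Cor. 1–2 of Thm. 1 (pp. 173–174)] -/
theorem natCard_setOf_range_stable_subvariety_eq_two_iff_isotypic :
    Nat.card {R : Set X.X.left | ∃ (Z : Motives.AbelianVariety K) (j : Z ⟶ X), IsClosedImmersion (Hom.toSchemeHom j) ∧
        R = Set.range (Hom.toSchemeHom j) ∧ ∀ φ : X ⟶ X, Set.range (Hom.toSchemeHom (j ≫ φ)) ⊆ Set.range (Hom.toSchemeHom j)} = 2 ↔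
      ∃ (C : Motives.AbelianVariety K) (n : ℕ), C.IsSimple ∧ 0 < C.dim ∧ IsIsogenous X (⨁ fun _ : Fin (n + 1) ↦ C) := by
  rw [natCard_setOf_range_stable_subvariety_eq_two_iff_isSimpleRing, isSimpleRing_endAlgebra_iff_exists_isIsogenous_biproduct_const]

variable {X} in
/-- A simple abelian variety of positive dimension has exactly two `End X`-stable abelian subvarieties (perfect field).
[cite: MumfordAV1970, §19 Cor. 2 of Thm. 1 (p. 174)] [cite: Lange2023AbelianVarietiesComplex, §2.4.4 Cor. 2.4.26 (PDF p. 124)] -/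
theorem natCard_setOf_range_stable_subvariety_eq_two_of_isSimple (hX : X.IsSimple) (h0 : 0 < X.dim) :
    Nat.card {R : Set X.X.left | ∃ (Z : Motives.AbelianVariety K) (j : Z ⟶ X), IsClosedImmersion (Hom.toSchemeHom j) ∧
        R = Set.range (Hom.toSchemeHom j) ∧ ∀ φ : X ⟶ X, Set.range (Hom.toSchemeHom (j ≫ φ)) ⊆ Set.range (Hom.toSchemeHom j)} = 2 :=
  (natCard_setOf_range_stable_subvariety_eq_two_iff_isSimpleRing X).2 (isSimpleRing_endAlgebra_of_isSimple_of_dim_pos hX h0)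

/-- **A power `C^{n+1}` of a simple `C` of positive dimension has exactly two `End`-stable abelian subvarieties** (`0` and `C^{n+1}`;
perfect field) — although for `n ≥ 1` it has infinitely many abelian subvarieties (`…SubvarietiesFiniteIffMultiplicityFree`).
[cite: Lange2023AbelianVarietiesComplex, §2.4.4 Cor. 2.4.26 (PDF p. 124)] [cite: MumfordAV1970, §19 Cor. 1–2 of Thm. 1 (pp. 173–174)] -/
theorem natCard_setOf_range_stable_subvariety_biproduct_const_eq_two {C : Motives.AbelianVariety K} (hC : C.IsSimple)
    (hC0 : 0 < C.dim) (n : ℕ) :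
    Nat.card {R : Set (⨁ fun _ : Fin (n + 1) ↦ C).X.left | ∃ (Z : Motives.AbelianVariety K) (j : Z ⟶ ⨁ fun _ : Fin (n + 1) ↦ C),
        IsClosedImmersion (Hom.toSchemeHom j) ∧ R = Set.range (Hom.toSchemeHom j) ∧
          ∀ φ : (⨁ fun _ : Fin (n + 1) ↦ C) ⟶ ⨁ fun _ : Fin (n + 1) ↦ C,
            Set.range (Hom.toSchemeHom (j ≫ φ)) ⊆ Set.range (Hom.toSchemeHom j)} = 2 :=
  (natCard_setOf_range_stable_subvariety_eq_two_iff_isotypic _).2 ⟨C, n, hC, hC0, ⟨𝟙 _, isIsogeny_id _⟩⟩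

end AbelianVariety

end Literature.AlgebraicGeometry.HodgeTheory

end
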